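import Mathlib
import Summits.AtomisticToContinuum.Crystallization.Theorems.ChessboardParticlePlanesLjLaminarWindowsGlueC5
import HarnessLib

/-! # Bounded spiky scales from the coin structure — stub `stub_bssOfCoins` of line `Sketch` (skeleton rev. 10, lead c6), crux `LjLaminarWindows` (stmt-AtomisticToContinuum-6711) -/

noncomputable section

open scoped BigOperators
open Filter Topology
open Literature.MathematicalPhysics.StatisticalMechanics
open Summit.AtomisticToContinuum.Crystallization.Theorems.ChargedEnergyGapNegative

namespace Summit.AtomisticToContinuum.Crystallization.Theorems.LjLaminarWindowsSketch

/-- The shell count `Sh(L)` is at most the full ordered-pair count `F(L)`. [folklore] -/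
private lemma bssOfCoins_shell_le_pairCount {N : ℕ} (x : Fin N → E3) (L R : ℝ) :
    ((Finset.univ.filter fun p : Fin N × Fin N =>
        L - R < dist (x p.1) (x p.2) ∧ dist (x p.1) (x p.2) ≤ L).card : ℝ) ≤
      ((Finset.univ.filter fun p : Fin N × Fin N => dist (x p.1) (x p.2) ≤ L).card : ℝ) := by
  exact_mod_cast Finset.card_le_card (by
    intro p hp
    simp only [Finset.mem_filter, Finset.mem_univ, true_and] at hp ⊢
    exact hp.2)

/-- Splitting the ordered-pair count at `L - R` for `0 ≤ R`: `F(L) = F(L - R) + Sh(L)`.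
[folklore] -/
private lemma bssOfCoins_pairCount_split {N : ℕ} (x : Fin N → E3) (L R : ℝ) (hR : 0 ≤ R) :
    ((Finset.univ.filter fun p : Fin N × Fin N => dist (x p.1) (x p.2) ≤ L).card : ℝ) =
      ((Finset.univ.filter fun p : Fin N × Fin N => dist (x p.1) (x p.2) ≤ L - R).card : ℝ) +
      ((Finset.univ.filter fun p : Fin N × Fin N =>
        L - R < dist (x p.1) (x p.2) ∧ dist (x p.1) (x p.2) ≤ L).card : ℝ) := by
  have hdisj : Disjoint
      (Finset.univ.filter fun p : Fin N × Fin N => dist (x p.1) (x p.2) ≤ L - R)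
      (Finset.univ.filter fun p : Fin N × Fin N =>
        L - R < dist (x p.1) (x p.2) ∧ dist (x p.1) (x p.2) ≤ L) := by
    rw [Finset.disjoint_filter]
    intro p _ h1 h2
    exact absurd h2.1 (not_lt.mpr h1)
  have hunion : (Finset.univ.filter fun p : Fin N × Fin N => dist (x p.1) (x p.2) ≤ L) =
      (Finset.univ.filter fun p : Fin N × Fin N => dist (x p.1) (x p.2) ≤ L - R) ∪
      (Finset.univ.filter fun p : Fin N × Fin N =>
        L - R < dist (x p.1) (x p.2) ∧ dist (x p.1) (x p.2) ≤ L) := by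
    ext p
    simp only [Finset.mem_filter, Finset.mem_union, Finset.mem_univ, true_and]
    constructor
    · intro h
      by_cases h' : dist (x p.1) (x p.2) ≤ L - R
      · exact Or.inl h'
      · exact Or.inr ⟨not_le.mp h', h⟩
    · rintro (h | h)
      · linarith
      · exact h.2
  rw [hunion, Finset.card_union_of_disjoint hdisj, Nat.cast_add]

/-- Pairs with a common label lie within distance `D` when every label class sits in a ball of
radius `ρ` with `2ρ ≤ D`. [folklore] -/
private lemma bssOfCoins_label_subset {N : ℕ} (x : Fin N → E3) (lab : Fin N → ℕ) (ρ D : ℝ)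
    (hflat : ∀ l : ℕ, ∃ z : E3, ∀ p : Fin N, lab p = l → dist (x p) z ≤ ρ) (hD : 2 * ρ ≤ D) :
    (Finset.univ.filter fun p : Fin N × Fin N => lab p.1 = lab p.2) ⊆
      (Finset.univ.filter fun p : Fin N × Fin N => dist (x p.1) (x p.2) ≤ D) := by
  intro p hp
  simp only [Finset.mem_filter, Finset.mem_univ, true_and] at hp ⊢
  obtain ⟨z, hz⟩ := hflat (lab p.1)
  have h1 := hz p.1 rfl
  have h2 := hz p.2 hp.symm
  calc dist (x p.1) (x p.2) ≤ dist (x p.1) z + dist (x p.2) z := dist_triangle_right _ _ _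
    _ ≤ D := by linarith

/-- The coin-diameter inequality: `2 C √(L R) ≤ m` whenever `L ≤ C₆ m` and `4 C² C₆ R ≤ m`
(`R, L, m ≥ 0`). [folklore] -/
private lemma bssOfCoins_coin_diam_le (C C₆ R L m : ℝ) (hR : 0 ≤ R) (hm : 0 ≤ m) (hL : 0 ≤ L)
    (hLm : L ≤ C₆ * m) (hRm : 4 * C ^ 2 * C₆ * R ≤ m) :
    2 * (C * Real.sqrt (L * R)) ≤ m := by
  have hLR : 0 ≤ L * R := mul_nonneg hL hR
  have h1 : (2 * (C * Real.sqrt (L * R))) ^ 2 ≤ m ^ 2 := by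
    calc (2 * (C * Real.sqrt (L * R))) ^ 2 = 4 * C ^ 2 * (L * R) := by
          rw [mul_pow, mul_pow, Real.sq_sqrt hLR]; ring
      _ ≤ 4 * C ^ 2 * (C₆ * m * R) := by
          apply mul_le_mul_of_nonneg_left _ (by positivity)
          exact mul_le_mul_of_nonneg_right hLm hR
      _ = (4 * C ^ 2 * C₆ * R) * m := by ring
      _ ≤ m * m := mul_le_mul_of_nonneg_right hRm hm
      _ = m ^ 2 := (sq m).symm
  exact (abs_le_of_sq_le_sq' h1 hm).2

/-- **C6f — bounded spiky scales from the coin structure** (provable now; the cross-scale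
accounting): coin structure (C6a) + geometric growth (C6b) + comparability of spiky scales (C6e's
conclusion) ⇒ `stub_boundedSpikes`.  With `L₁ = min Λ` and `max Λ ≤ C₆ L₁`, every coin of every
scale in `Λ` has diameter `≤ 2C√(C₆ L₁ R) ≤ L₁`, so `F(L) < (2c/κ) F(L₁)` on `Λ`, against
`F(max Λ) ≥ (1−κ)^{−(#Λ−1)} F(L₁)`: `#Λ ≤ K₀` with `(1−κ)^{K₀} ≤ κ/(2c)` (`K₀ = 0` if `κ ≥ 1`). [folklore] -/
theorem stub_bssOfCoins
    (hI : ∀ θ R : ℝ, 0 < θ → 1 ≤ R → ∃ c C L₀ : ℝ, 0 < c ∧ 1 ≤ C ∧ ∀ L : ℝ, L₀ ≤ L →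
      ∀ (N : ℕ) (x : Fin N → E3),
      (∀ j k : Fin N, j ≠ k → (7 : ℝ) / 10 ≤ dist (x j) (x k)) →
      (∀ S : Finset (Fin N), S.Nonempty → Sᶜ.Nonempty →
          ∃ p ∈ S, ∃ k ∈ Sᶜ, dist (x p) (x k) ≤ 23 / 20) →
      ∃ lab : Fin N → ℕ,
        (∀ l : ℕ, ∃ (z : E3) (A : E3 →ₗᵢ[ℝ] E3), ∀ p : Fin N, lab p = l →
            |(A (x p - z)) 2| ≤ R ∧ dist (x p) z ≤ C * Real.sqrt (L * R)) ∧
        ((Finset.univ.filter fun p : Fin N × Fin N =>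
            L - R < dist (x p.1) (x p.2) ∧ dist (x p.1) (x p.2) ≤ L).card : ℝ) ≤
          c * ((Finset.univ.filter fun p : Fin N × Fin N => lab p.1 = lab p.2).card : ℝ) +
            θ * ((Finset.univ.filter fun p : Fin N × Fin N => dist (x p.1) (x p.2) ≤ L).card : ℝ))
    (hG : ∀ (F : ℝ → ℝ), Monotone F → ∀ κ R : ℝ, 0 < κ → κ < 1 → 0 < R →
      ∀ (Λ : Finset ℝ) (hΛ : Λ.Nonempty),
        (∀ L ∈ Λ, ∀ L' ∈ Λ, L ≠ L' → R ≤ |L - L'|) →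
        (∀ L ∈ Λ, κ * F L < F L - F (L - R)) →
        F (Λ.min' hΛ) ≤ (1 - κ) ^ (Λ.card - 1) * F (Λ.max' hΛ))
    (hA : ∀ κ R c C L_I : ℝ, 0 < κ → 1 ≤ R → 0 < c → 1 ≤ C →
      (∀ L : ℝ, L_I ≤ L → ∀ (N : ℕ) (x : Fin N → E3),
        (∀ j k : Fin N, j ≠ k → (7 : ℝ) / 10 ≤ dist (x j) (x k)) →
        (∀ S : Finset (Fin N), S.Nonempty → Sᶜ.Nonempty →
            ∃ p ∈ S, ∃ k ∈ Sᶜ, dist (x p) (x k) ≤ 23 / 20) →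
        ∃ lab : Fin N → ℕ,
          (∀ l : ℕ, ∃ (z : E3) (A : E3 →ₗᵢ[ℝ] E3), ∀ p : Fin N, lab p = l →
              |(A (x p - z)) 2| ≤ R ∧ dist (x p) z ≤ C * Real.sqrt (L * R)) ∧
          ((Finset.univ.filter fun p : Fin N × Fin N =>
              L - R < dist (x p.1) (x p.2) ∧ dist (x p.1) (x p.2) ≤ L).card : ℝ) ≤
            c * ((Finset.univ.filter fun p : Fin N × Fin N => lab p.1 = lab p.2).card : ℝ) +
              κ / 2 * ((Finset.univ.filter fun p : Fin N × Fin N =>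
                dist (x p.1) (x p.2) ≤ L).card : ℝ)) →
      ∃ C₆ L₁ : ℝ, 1 ≤ C₆ ∧ ∀ (N : ℕ) (x : Fin N → E3),
        (∀ j k : Fin N, j ≠ k → (7 : ℝ) / 10 ≤ dist (x j) (x k)) →
        (∀ S : Finset (Fin N), S.Nonempty → Sᶜ.Nonempty →
            ∃ p ∈ S, ∃ k ∈ Sᶜ, dist (x p) (x k) ≤ 23 / 20) →
        ∀ L L' : ℝ, L₁ ≤ L → L ≤ L' →
          κ * ((Finset.univ.filter fun p : Fin N × Fin N => dist (x p.1) (x p.2) ≤ L).card : ℝ) <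
            ((Finset.univ.filter fun p : Fin N × Fin N =>
                L - R < dist (x p.1) (x p.2) ∧ dist (x p.1) (x p.2) ≤ L).card : ℝ) →
          κ * ((Finset.univ.filter fun p : Fin N × Fin N => dist (x p.1) (x p.2) ≤ L').card : ℝ) <
            ((Finset.univ.filter fun p : Fin N × Fin N =>
                L' - R < dist (x p.1) (x p.2) ∧ dist (x p.1) (x p.2) ≤ L').card : ℝ) →
          L' ≤ C₆ * L) :
    ∀ κ R : ℝ, 0 < κ → 1 ≤ R → ∃ (K₀ : ℕ) (L₀ : ℝ), ∀ (N : ℕ) (x : Fin N → E3),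
      (∀ j k : Fin N, j ≠ k → (7 : ℝ) / 10 ≤ dist (x j) (x k)) →
      (∀ S : Finset (Fin N), S.Nonempty → Sᶜ.Nonempty →
          ∃ p ∈ S, ∃ k ∈ Sᶜ, dist (x p) (x k) ≤ 23 / 20) →
      ∀ Λ : Finset ℝ, (∀ L ∈ Λ, L₀ ≤ L) → (∀ L ∈ Λ, ∀ L' ∈ Λ, L ≠ L' → R ≤ |L - L'|) →
        (∀ L ∈ Λ, κ * ((Finset.univ.filter fun p : Fin N × Fin N => dist (x p.1) (x p.2) ≤ L).card : ℝ) <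
            ((Finset.univ.filter fun p : Fin N × Fin N =>
                L - R < dist (x p.1) (x p.2) ∧ dist (x p.1) (x p.2) ≤ L).card : ℝ)) →
        Λ.card ≤ K₀ := by
  intro κ R hκ hR
  by_cases hκ1 : 1 ≤ κ
  · -- no spiky scale exists when `κ ≥ 1`, since `Sh(L) ≤ F(L) ≤ κ F(L)`
    refine ⟨0, 0, fun N x _ _ Λ _ _ hsp => ?_⟩
    rcases Λ.eq_empty_or_nonempty with hΛe | ⟨L, hL⟩
    · simp [hΛe]
    · exfalso
      have h1 := hsp L hL
      have h2 := bssOfCoins_shell_le_pairCount x L R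
      have h3 : ((Finset.univ.filter fun p : Fin N × Fin N =>
            dist (x p.1) (x p.2) ≤ L).card : ℝ) ≤
          κ * ((Finset.univ.filter fun p : Fin N × Fin N =>
            dist (x p.1) (x p.2) ≤ L).card : ℝ) :=
        le_mul_of_one_le_left (Nat.cast_nonneg _) hκ1
      linarith
  replace hκ1 : κ < 1 := not_le.mp hκ1
  obtain ⟨c, C, L_I, hc, hC, hI'⟩ := hI (κ / 2) R (by positivity) hR
  obtain ⟨C₆, L₁, -, hA'⟩ := hA κ R c C L_I hκ hR hc hC hI'
  obtain ⟨K, hK⟩ := exists_pow_lt_of_lt_one (show 0 < κ / (4 * c) by positivity)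
    (show 1 - κ < 1 by linarith)
  refine ⟨K, max (max L_I L₁) (max (4 * C ^ 2 * C₆ * R) 1), ?_⟩
  intro N x hsep hconn Λ hΛ0 hΛsep hsp
  rcases Λ.eq_empty_or_nonempty with hΛe | hne
  · simp [hΛe]
  have hL0 : ∀ L ∈ Λ, (L_I ≤ L ∧ L₁ ≤ L) ∧ (4 * C ^ 2 * C₆ * R ≤ L ∧ 1 ≤ L) := fun L hL => by
    simpa only [max_le_iff] using hΛ0 L hL
  have hR0 : 0 < R := by linarith
  -- the pair count `F` and the shell count `S` as (opaque) functions of the scale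
  obtain ⟨F, hF⟩ : ∃ F : ℝ → ℝ, ∀ r, F r =
      ((Finset.univ.filter fun p : Fin N × Fin N => dist (x p.1) (x p.2) ≤ r).card : ℝ) :=
    ⟨fun r => ((Finset.univ.filter fun p : Fin N × Fin N =>
      dist (x p.1) (x p.2) ≤ r).card : ℝ), fun _ => rfl⟩
  obtain ⟨S, hS⟩ : ∃ S : ℝ → ℝ, ∀ r, S r =
      ((Finset.univ.filter fun p : Fin N × Fin N =>
        r - R < dist (x p.1) (x p.2) ∧ dist (x p.1) (x p.2) ≤ r).card : ℝ) :=
    ⟨fun r => ((Finset.univ.filter fun p : Fin N × Fin N =>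
      r - R < dist (x p.1) (x p.2) ∧ dist (x p.1) (x p.2) ≤ r).card : ℝ), fun _ => rfl⟩
  have hspF : ∀ L ∈ Λ, κ * F L < S L := fun L hL => by rw [hF, hS]; exact hsp L hL
  have hF0 : ∀ r, 0 ≤ F r := fun r => by rw [hF]; exact Nat.cast_nonneg _
  have hFmono : Monotone F := by
    intro a b hab
    rw [hF, hF]
    exact_mod_cast Finset.card_le_card (by
      intro p hp
      simp only [Finset.mem_filter, Finset.mem_univ, true_and] at hp ⊢
      exact hp.trans hab)
  have hgrowth : ∀ L ∈ Λ, κ * F L < F L - F (L - R) := fun L hL => by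
    have h1 := hspF L hL
    have h2 : F L = F (L - R) + S L := by
      rw [hF, hF, hS]; exact bssOfCoins_pairCount_split x L R hR0.le
    linarith
  -- the extreme scales
  have hm_mem : Λ.min' hne ∈ Λ := Finset.min'_mem Λ hne
  have hM_mem : Λ.max' hne ∈ Λ := Finset.max'_mem Λ hne
  -- (i) all scales of `Λ` are within a factor `C₆` of the smallest one
  have hratio : ∀ L ∈ Λ, L ≤ C₆ * Λ.min' hne := fun L hL =>
    hA' N x hsep hconn (Λ.min' hne) L (hL0 _ hm_mem).1.2 (Finset.min'_le Λ L hL)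
      (hsp _ hm_mem) (hsp L hL)
  -- (ii) the octave bound `F(L) < (2c/κ) F(min Λ)` on `Λ`
  have hoct : ∀ L ∈ Λ, F L < 2 / κ * (c * F (Λ.min' hne)) := by
    intro L hL
    obtain ⟨lab, hflat, hcount⟩ := hI' L (hL0 L hL).1.1 N x hsep hconn
    have hc1 : S L ≤
        c * ((Finset.univ.filter fun p : Fin N × Fin N => lab p.1 = lab p.2).card : ℝ) +
          κ / 2 * F L := by
      rw [hS, hF]; exact hcount
    have hdiam : 2 * (C * Real.sqrt (L * R)) ≤ Λ.min' hne :=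
      bssOfCoins_coin_diam_le C C₆ R L (Λ.min' hne) hR0.le (by linarith [(hL0 _ hm_mem).2.2])
        (by linarith [(hL0 L hL).2.2]) (hratio L hL) (hL0 _ hm_mem).2.1
    have hsub := bssOfCoins_label_subset x lab (C * Real.sqrt (L * R)) (Λ.min' hne)
      (fun l => by
        obtain ⟨z, _A, hzA⟩ := hflat l
        exact ⟨z, fun p hp => (hzA p hp).2⟩) hdiam
    have hQ : ((Finset.univ.filter fun p : Fin N × Fin N => lab p.1 = lab p.2).card : ℝ) ≤
        F (Λ.min' hne) := by
      rw [hF]; exact_mod_cast Finset.card_le_card hsub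
    have h1 := hspF L hL
    have h2 : κ / 2 * F L < c * F (Λ.min' hne) := by
      have := mul_le_mul_of_nonneg_left hQ hc.le
      linarith
    calc F L = 2 / κ * (κ / 2 * F L) := by field_simp
      _ < 2 / κ * (c * F (Λ.min' hne)) := mul_lt_mul_of_pos_left h2 (by positivity)
  -- (iii) geometric growth along `Λ`
  have hG' := hG F hFmono κ R hκ hκ1 hR0 Λ hne hΛsep hgrowth
  -- (iv) `F(min Λ) > 0`: the diagonal pair of any particle is counted
  have hFm_pos : 0 < F (Λ.min' hne) := by
    have hS0 : 0 < S (Λ.min' hne) :=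
      lt_of_le_of_lt (mul_nonneg hκ.le (hF0 _)) (hspF _ hm_mem)
    rw [hS] at hS0
    have hS0' : 0 < (Finset.univ.filter fun p : Fin N × Fin N =>
        Λ.min' hne - R < dist (x p.1) (x p.2) ∧ dist (x p.1) (x p.2) ≤ Λ.min' hne).card := by
      exact_mod_cast hS0
    obtain ⟨p, -⟩ := Finset.card_pos.mp hS0'
    rw [hF]
    refine Nat.cast_pos.mpr (Finset.card_pos.mpr ⟨(p.1, p.1), ?_⟩)
    simp only [Finset.mem_filter, Finset.mem_univ, true_and, dist_self]
    linarith [(hL0 _ hm_mem).2.2]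
  -- (v) comparison of (ii) at `max Λ` with (iii)
  have hpow_pos : 0 < (1 - κ) ^ (Λ.card - 1) := pow_pos (by linarith) _
  have hkey : κ / (4 * c) < (1 - κ) ^ (Λ.card - 1) := by
    have h3 : F (Λ.min' hne) < (1 - κ) ^ (Λ.card - 1) * (2 / κ * (c * F (Λ.min' hne))) :=
      lt_of_le_of_lt hG' (mul_lt_mul_of_pos_left (hoct _ hM_mem) hpow_pos)
    have h4 : 1 * F (Λ.min' hne) <
        ((1 - κ) ^ (Λ.card - 1) * (2 / κ * c)) * F (Λ.min' hne) := by
      calc 1 * F (Λ.min' hne) = F (Λ.min' hne) := one_mul _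
        _ < (1 - κ) ^ (Λ.card - 1) * (2 / κ * (c * F (Λ.min' hne))) := h3
        _ = ((1 - κ) ^ (Λ.card - 1) * (2 / κ * c)) * F (Λ.min' hne) := by ring
    have h5 : 1 < (1 - κ) ^ (Λ.card - 1) * (2 / κ * c) :=
      lt_of_mul_lt_mul_right h4 hFm_pos.le
    have h6 : κ / (4 * c) ≤ κ / (2 * c) := by
      have e : κ / (4 * c) = (1 / 2) * (κ / (2 * c)) := by
        field_simp
        ring
      have : 0 < κ / (2 * c) := by positivity
      rw [e]; linarith
    calc κ / (4 * c) ≤ κ / (2 * c) := h6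
      _ = 1 * (κ / (2 * c)) := (one_mul _).symm
      _ < ((1 - κ) ^ (Λ.card - 1) * (2 / κ * c)) * (κ / (2 * c)) :=
          mul_lt_mul_of_pos_right h5 (by positivity)
      _ = (1 - κ) ^ (Λ.card - 1) := by
          field_simp
  by_contra hcard
  have hK' : K ≤ Λ.card - 1 := by omega
  have h1 : (1 - κ) ^ (Λ.card - 1) ≤ (1 - κ) ^ K :=
    pow_le_pow_of_le_one (by linarith) (by linarith) hK'
  linarith

end Summit.AtomisticToContinuum.Crystallization.Theorems.LjLaminarWindowsSketch

end
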